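import Summits.KontsevichZagierPeriods.KontsevichZagierPeriods.Theses.LinRedNormalForm
import Summits.KontsevichZagierPeriods.KontsevichZagierPeriods.Theses.CompiledSubstitutions
import Summits.KontsevichZagierPeriods.KontsevichZagierPeriods.Theses.FurushoPentagon
import Literature.NumberTheory.Transcendental.MultipleZetaRepeatedTwosProofs

/-!
# Crux `LinRedNormalForm.HoffmanSpanInKZ` (stmt-KontsevichZagierPeriods-15044) — ideator 2, round 1

First lemmas of the two idea cards (crux-ideate; no skeleton at this stage):

* card `even-column-newton-pi-box` : `DoublingMove`, `EvenColumn`, `evenColumn_instances`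
  (PROVED: the even column is literally a family of instances of the crux), `EvenColumnTransfer`;
* card `odd-column-star-zagier-level-two` : `starKernel`, `etaKernel`, `phiKernel`,
  `StarZagierWeightThree`, `StarZagierLevelTwo`, `OddColumn`, `oddColumn_instances` (PROVED),
  `OddColumnTransfer`.
-/

namespace Summit.KontsevichZagierPeriods.KontsevichZagierPeriods.Cruxes.HoffmanSpanInKZ.IdeatorTwo

open Set
open Literature.NumberTheory.Transcendental

/-- The open unit cube `(0,1)ⁿ`. -/
def cube (n : ℕ) : Set (Fin n → ℝ) := {x | ∀ i, x i ∈ Ioo (0:ℝ) 1}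

/-- The open ordered simplex of the crux, `{1 > t₀ > ⋯ > t_{w-1} > 0}` (= `KZ.openOrderedSimplex w`, rfl). -/
def simplex (w : ℕ) : Set (Fin w → ℝ) := {t | (∀ i, 0 < t i) ∧ (∀ i, t i < 1) ∧ StrictAnti t}

/-- The Hoffman generator set of the crux in weight `w` (verbatim the set in `HoffmanSpanInKZ`). -/
def hoffmanGens (w : ℕ) : Set KZ.FormalRep :=
  {x | ∃ (u : List ℕ) (q' : ℚ) (s' : KZ.IntegralRep (MZV.weight u)),
    MZV.IsHoffman u ∧ MZV.weight u = w ∧ s'.domain = simplex _ ∧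
    EqOn s'.integrand (fun t => (q' : ℝ) * KZ.mzvIntegrand u t) s'.domain ∧ x = KZ.of s'}

/-- The depth-one letter pattern `0^{w-1} 1` (the word of `ζ(w)`): only the last (smallest)
simplex variable carries `dt/(1-t)`. -/
def depthOneLetters (w : ℕ) : Fin w → Bool := fun i => decide ((i : ℕ) + 1 = w)

/-! ## Card A — the even column by Newton's identities over the π-box -/

/-- **Doubling move** (first lemma of card A, provable now: ONE change of variables `x ↦ x²`
componentwise on the cube, rule 2, Jacobian `∏ 2xᵢ`): `[(0,1)ⁿ, P/(1-P²)] ~ [(0,1)ⁿ, 2⁻ⁿ/(1-P)]`,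
`P = ∏ xᵢ` (values `∑_{k even ≥ 2} k⁻ⁿ = 2⁻ⁿ ζ(n)`). With integrand additivity
`1/(1-P) = 1/(1-P²) + P/(1-P²)` it realises `(1 - 2⁻ⁿ)·[ζ(n)] ≡ [λ(n)]` inside the calculus. -/
def DoublingMove : Prop :=
  ∀ (n : ℕ), 2 ≤ n → ∀ (r r' : KZ.IntegralRep n), r.domain = cube n →
    EqOn r.integrand (fun x => (∏ i, x i) / (1 - (∏ i, x i) ^ 2)) r.domain →
    r'.domain = cube n →
    EqOn r'.integrand (fun x => (1 / 2 ^ n) / (1 - ∏ i, x i)) r'.domain →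
    KZ.Equivalent r r'

/-- **The even column of `HoffmanSpanInKZ`** (all weights): the word generator of `q·ζ(2m)` is
congruent modulo `KZ.relations` to ONE Hoffman generator `q'·ζ(2,…,2)` (`m` twos). -/
def EvenColumn : Prop :=
  ∀ (m : ℕ), 1 ≤ m → ∀ (q : ℚ) (s : KZ.IntegralRep (2 * m)), s.domain = simplex (2 * m) →
    EqOn s.integrand
      (fun t => (q : ℝ) * ∏ i, if depthOneLetters (2 * m) i then 1 / (1 - t i) else 1 / t i) s.domain →
    ∃ (q' : ℚ) (s' : KZ.IntegralRep (MZV.weight (List.replicate m 2))),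
      s'.domain = simplex _ ∧
      EqOn s'.integrand (fun t => (q' : ℝ) * KZ.mzvIntegrand (List.replicate m 2) t) s'.domain ∧
      KZ.of s - KZ.of s' ∈ KZ.relations

/-- `EvenColumn` is literally a family of instances of the crux (`w = 2m`, `ε = 0^{2m-1}1`). -/
theorem evenColumn_instances (h : EvenColumn) (m : ℕ) (hm : 1 ≤ m) (q : ℚ)
    (s : KZ.IntegralRep (2 * m)) (hd : s.domain = simplex (2 * m))
    (hi : EqOn s.integrand
      (fun t => (q : ℝ) * ∏ i, if depthOneLetters (2 * m) i then 1 / (1 - t i) else 1 / t i) s.domain) :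
    ∃ c ∈ AddSubgroup.closure (hoffmanGens (2 * m)), KZ.of s - c ∈ KZ.relations := by
  obtain ⟨q', s', hd', hi', hrel⟩ := h m hm q s hd hi
  refine ⟨KZ.of s', AddSubgroup.subset_closure ?_, hrel⟩
  exact ⟨List.replicate m 2, q', s', MZV.isHoffman_replicate_two m, MZV.weight_replicate_two m,
    hd', hi', rfl⟩

/-- **Transfer of card A**: the even column follows from route CompiledSubstitutions' crux
`ZetaEvenBKC` (stmt-3382: `[(0,1)^{2k}, 1/(1-∏x²)] ~ [(0,1)^{2k}, q·∏1/(1+x²)]`, ONE algebraic change of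
variables + Elkies' dissection), the landed `StuffleInKZ` (Newton's identities
`(n+1)ζ({2}ⁿ⁺¹) = ∑ (-1)ʲ ζ(2j+2) ζ({2}^{n-j})` are ℤ-combinations of stuffle instances),
`IntegerDivision` (division by `n+1`) and `DoublingMove`; products of π-boxes are π-boxes
(`KZ.of_mul_of`, `KZ.of_mul_mem_relations`), cube ↔ simplex by the landed CubicalChart. -/
def EvenColumnTransfer : Prop :=
  Theses.CompiledSubstitutions.ZetaEvenBKC → Theses.FurushoPentagon.StuffleInKZ →
    Theses.FurushoPentagon.IntegerDivision → DoublingMove → EvenColumn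

/-! ## Card B — the odd column through the level-two identity for `ζ⋆(2ᵃ 3 2ᵇ)` -/

/-- Cube kernel of the STAR sum `ζ⋆(s) = ∑_{n₁ ≥ ⋯ ≥ n_d ≥ 1} ∏ nᵢ^{-sᵢ}`:
`∏_{i ≤ d} 1/(1 - P_i)`, `P_i` the product of the cube variables of the first `i` blocks. -/
noncomputable def starKernel (s : List ℕ) (x : Fin (MZV.weight s) → ℝ) : ℝ :=
  ∏ i : Fin s.length, 1 / (1 - ∏ j : Fin (MZV.weight s), if (j : ℕ) < (s.take (i + 1)).sum then x j else 1)

/-- Cube kernel of `η(N) = ∑ (-1)^{n-1} n^{-N}`. -/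
noncomputable def etaKernel (N : ℕ) (x : Fin N → ℝ) : ℝ := 1 / (1 + ∏ j, x j)

/-- Cube kernel of MINUS the alternating double sum `φ(p;q) = ∑_{k>j≥1} (-1)^{k-1} k^{-p} j^{-q}`
(`N = p + q`): `X/((1+X)(1+XY))`, `X = x₀⋯x_{p-1}`, `XY = ∏ xⱼ`; a POSITIVE rational function. -/
noncomputable def phiKernel (p N : ℕ) (x : Fin N → ℝ) : ℝ :=
  (∏ j : Fin N, if (j : ℕ) < p then x j else 1) /
    ((1 + ∏ j : Fin N, if (j : ℕ) < p then x j else 1) * (1 + ∏ j, x j))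

/-- The index `2ᵃ 3 2ᵇ` = `(2,…,2,3,2,…,2)` (`a` twos, then `3`, then `b` twos). -/
def hoff232 (a b : ℕ) : List ℕ := List.replicate a 2 ++ 3 :: List.replicate b 2

/-- **First lemma of card B (weight 3, `a = b = 0`)**: `ζ(3) - 2η(3) - 4φ(2;1) = 0` as ONE element of
`KZ.relations` among three rational cube integrals in dimension 3:
`[1/(1-xyz)] - 2[1/(1+xyz)] + 4[xy/((1+xy)(1+xyz))] ∈ relations`
(values `ζ(3)`, `¾ζ(3)`, `⅛ζ(3)`; checked numerically here). -/
def StarZagierWeightThree : Prop :=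
  ∀ (r₁ r₂ r₃ : KZ.IntegralRep 3), r₁.domain = cube 3 →
    EqOn r₁.integrand (fun x => 1 / (1 - x 0 * x 1 * x 2)) r₁.domain →
    r₂.domain = cube 3 → EqOn r₂.integrand (fun x => 1 / (1 + x 0 * x 1 * x 2)) r₂.domain →
    r₃.domain = cube 3 →
    EqOn r₃.integrand (fun x => x 0 * x 1 / ((1 + x 0 * x 1) * (1 + x 0 * x 1 * x 2))) r₃.domain →
    KZ.of r₁ - 2 • KZ.of r₂ + 4 • KZ.of r₃ ∈ KZ.relations

/-- **C⁺ of card B**: for all `a, b`, with `N = 2a+2b+3`,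
`ζ⋆(2ᵃ 3 2ᵇ) = 2 η(N) + 4 φ(2a+2; 2b+1)` as a three-term element of `KZ.relations` among rational cube
integrals in dimension `N` (the identity is verified numerically here for `a+b ≤ 2` and follows, at
`n → ∞`, from the exact finite identities
`H⋆_n(2ᵃ 3 2ᵇ) = ∑_{k≤n} (-1)^{k-1} C(n,k)/C(n+k,k) · [2/k^N + 4 H_{k-1}(2b+1)/k^{2a+2}]`
verified here in exact arithmetic). -/
def StarZagierLevelTwo : Prop :=
  ∀ (a b : ℕ) (r₁ r₂ r₃ : KZ.IntegralRep (MZV.weight (hoff232 a b))),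
    r₁.domain = cube _ → EqOn r₁.integrand (starKernel (hoff232 a b)) r₁.domain →
    r₂.domain = cube _ → EqOn r₂.integrand (etaKernel _) r₂.domain →
    r₃.domain = cube _ → EqOn r₃.integrand (phiKernel (2 * a + 2) _) r₃.domain →
    KZ.of r₁ - 2 • KZ.of r₂ + 4 • KZ.of r₃ ∈ KZ.relations

/-- **The odd column of `HoffmanSpanInKZ`** (all weights `2m+1 ≥ 3`): the word generator of
`q·ζ(2m+1)` is congruent modulo `KZ.relations` to a ℤ-combination of Hoffman generators of weight
`2m+1` (at the value level: `ζ(2m+1) ∈ hoffmanSpan (2m+1)`, tree theorem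
`multipleZeta_odd_mem_hoffmanSpan`, by Zagier's theorem and Brown's unit-triangular level matrix). -/
def OddColumn : Prop :=
  ∀ (m : ℕ), 1 ≤ m → ∀ (q : ℚ) (s : KZ.IntegralRep (2 * m + 1)), s.domain = simplex (2 * m + 1) →
    EqOn s.integrand
      (fun t => (q : ℝ) * ∏ i, if depthOneLetters (2 * m + 1) i then 1 / (1 - t i) else 1 / t i)
      s.domain →
    ∃ c ∈ AddSubgroup.closure (hoffmanGens (2 * m + 1)), KZ.of s - c ∈ KZ.relations

/-- `OddColumn` is literally a family of instances of the crux (`w = 2m+1`, `ε = 0^{2m}1`). -/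
theorem oddColumn_instances (h : OddColumn) (m : ℕ) (hm : 1 ≤ m) (q : ℚ)
    (s : KZ.IntegralRep (2 * m + 1)) (hd : s.domain = simplex (2 * m + 1))
    (hi : EqOn s.integrand
      (fun t => (q : ℝ) * ∏ i, if depthOneLetters (2 * m + 1) i then 1 / (1 - t i) else 1 / t i)
      s.domain) :
    ∃ c ∈ AddSubgroup.closure (hoffmanGens (2 * m + 1)), KZ.of s - c ∈ KZ.relations :=
  h m hm q s hd hi

/-- **Level-two depth-two parity in the calculus** (input (K3) of card B; per instance within the
level-two engine FDS₂ + σ, uniform formulas Borwein–Borwein–Girgensohn 1995): for `p ≥ 2`, `q ≥ 1`,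
`p + q` odd, the cube representation of `-φ(p;q)` is congruent modulo `KZ.relations` to a
ℤ-combination of PRODUCTS `[ζ(2r+1)-word] · [even cube box 1/(1∓P)]` and of the depth-one boxes
`[1/(1∓P)]` in dimension `p+q`. -/
def AltDepthTwoParity : Prop :=
  ∀ (p q : ℕ), 2 ≤ p → 1 ≤ q → Odd (p + q) → ∀ (r : KZ.IntegralRep (p + q)),
    r.domain = cube _ → EqOn r.integrand (phiKernel p _) r.domain →
    ∃ c ∈ AddSubgroup.closure
      ({x | ∃ (n j : ℕ) (c₁ c₂ : ℚ) (u : KZ.IntegralRep (2 * n + 3)) (v : KZ.IntegralRep (2 * j)),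
          (2 * n + 3) + 2 * j = p + q ∧ u.domain = simplex _ ∧
          EqOn u.integrand (fun t => (c₁ : ℝ) * ∏ i, if depthOneLetters (2 * n + 3) i
            then 1 / (1 - t i) else 1 / t i) u.domain ∧
          v.domain = cube _ ∧
          (EqOn v.integrand (fun x => (c₂ : ℝ) / (1 - ∏ i, x i)) v.domain ∨
            EqOn v.integrand (fun x => (c₂ : ℝ) / (1 + ∏ i, x i)) v.domain) ∧
          x = KZ.of u * KZ.of v} ∪
        {x | ∃ (c₁ : ℚ) (u : KZ.IntegralRep (p + q)), u.domain = cube _ ∧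
          (EqOn u.integrand (fun x => (c₁ : ℝ) / (1 - ∏ i, x i)) u.domain ∨
            EqOn u.integrand (fun x => (c₁ : ℝ) / (1 + ∏ i, x i)) u.domain) ∧ x = KZ.of u}),
      KZ.of r - c ∈ KZ.relations

/-- **Transfer of card B**: `OddColumn` from the C⁺ `StarZagierLevelTwo`, the level-two parity (K3),
the star ↔ non-star generating identity (stuffle, landed `StuffleInKZ`), `DoublingMove` + `EvenColumn`
for the even boxes, `IntegerDivision`, and — for the final inversion — Brown's unit-triangular
level-one matrix (tree: `Brown2012.isUnit_levelMatrix`, proved). -/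
def OddColumnTransfer : Prop :=
  StarZagierLevelTwo → AltDepthTwoParity → Theses.FurushoPentagon.StuffleInKZ →
    Theses.FurushoPentagon.IntegerDivision → DoublingMove → EvenColumn → OddColumn

/-- **The depth-one column of the crux.** `EvenColumn ∧ OddColumn` give, for EVERY weight `w ≥ 2`,
the instance `ε = 0^{w-1}1` (the word of `ζ(w)`) of `LinRedNormalForm.HoffmanSpanInKZ`, with the
crux's conclusion written VERBATIM. -/
theorem depthOneColumn_of_columns (hE : EvenColumn) (hO : OddColumn) (w : ℕ) (hw : 2 ≤ w)
    (q : ℚ) (s : KZ.IntegralRep w)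
    (hd : s.domain = {t | (∀ i, 0 < t i) ∧ (∀ i, t i < 1) ∧ StrictAnti t})
    (hi : EqOn s.integrand
      (fun t => (q : ℝ) * ∏ i, if depthOneLetters w i then 1 / (1 - t i) else 1 / t i) s.domain) :
    ∃ m ∈ AddSubgroup.closure {x : KZ.FormalRep | ∃ (u : List ℕ) (q' : ℚ)
        (s' : KZ.IntegralRep (MZV.weight u)), MZV.IsHoffman u ∧ MZV.weight u = w ∧
        s'.domain = {t | (∀ i, 0 < t i) ∧ (∀ i, t i < 1) ∧ StrictAnti t} ∧
        Set.EqOn s'.integrand (fun t => (q' : ℝ) * KZ.mzvIntegrand u t) s'.domain ∧ x = KZ.of s'},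
      KZ.of s - m ∈ KZ.relations := by
  obtain ⟨m, rfl | rfl⟩ := Nat.even_or_odd' w
  · exact evenColumn_instances hE m (by omega) q s hd hi
  · rcases Nat.eq_zero_or_pos m with rfl | hm
    · -- w = 1: no admissible word; the hypothesis forces the weight-one generator, excluded by `hw`
      omega
    · exact oddColumn_instances hO m hm q s hd hi

end Summit.KontsevichZagierPeriods.KontsevichZagierPeriods.Cruxes.HoffmanSpanInKZ.IdeatorTwo
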